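import Mathlib
import HarnessLib
import Summits.AtomisticToContinuum.Statement
import Literature.Geometry.DiscreteGeometry.KissingPatterns
import Literature.Probability.Process.PointStationaryLaw
import Literature.MathematicalPhysics.StatisticalMechanics.RootEnergy
import Literature.MathematicalPhysics.StatisticalMechanics.Crystallization
import Literature.MathematicalPhysics.StatisticalMechanics.MuGroundStateConfiguration
import Literature.MathematicalPhysics.StatisticalMechanics.BarlowStacking
import Literature.MathematicalPhysics.StatisticalMechanics.HaggStacking
import Summits.AtomisticToContinuum.Crystallization.Theorems.GrainCoreNetworkSplitDiluteRung

/-!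
# RepetitiveNetworkReduction, Line A «repetitive-rigidity» — the evaporation ladder and its rung `δ ≥ 16/5`
# in the CURRENT binder shape (decomp-a2c lens 2, g19)

Supports the residual crux `RepetitiveNetworkReduction.RepetitiveNetworkLawGap` (stmt-AtomisticToContinuum-27568) through
its registered Line-A skeleton (sha256 ff3c3003…, g19): the open stub `stub_repetitiveRigidity` (XL, the content) says that
NO rooted `δ`-separated textured Nash non-periodic grain-free core-free uniformly recurrent point set is an `e⋆`-μGSC of
`V_LJ` (`e⋆ = ⨅_Q e(Q)`).

* `not_isMuGSC_eStar_of_binding_lt` — THE EVAPORATION LADDER AS A FUNCTION OF THE CERTIFIED THRESHOLD: if `e⋆ ≤ e_up` and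
  `(250/6)·δ⁻⁶ < −e_up`, then no `δ`-separated set containing an atom is an `e⋆`-μGSC of `V_LJ` (the atom's one-body energy
  is `≥ −(250/6)·δ⁻⁶ > e_up ≥ e⋆` by the tree shell bound `FrustratedLawDichotomyPeriodicRungs.neg_le_tsum_lennardJones`,
  so removing it lowers `U − e⋆·#`: `GrainCoreNetworkSplitDiluteRung.rung_evaporableAtom`).  Every sharper certified
  upper bound on `e⋆` lowers the rung with no new work: `e_up = −1/24` (dimer, in this import cone) gives `δ ≥ 3.17`;
  `−1/8` (unit tetrahedron, `NashTwoShellGap.Negative.Shape.eStar_le_neg_one_eighth`) `2.64`; `−1/2` (fcc at unit spacing,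
  `LayeredLawsSelectHcp.Negative.Threshold.eStar_le_neg_half`) `2.09`; `−0.711` (fcc, twenty shells,
  `ThreeConeCertificateOnePercentCertificateFccRung.eStar_le_neg`) `1.97` — the last three live in modules not co-built
  with this chain on the farm today, hence are not imported here.
* `not_isMuGSC_eStar_of_sep` — the instance `δ ≥ 16/5` from `e⋆ ≤ −1/24` (dimer bound, inlined; `(250/6)·(5/16)⁶ < 1/24`).
* `repetitiveRigidity_rung_sep` — **RUNG `δ ≥ 16/5` of `stub_repetitiveRigidity` in the EXACT binder shape of the CURRENT
  registered stub text** (v2 numerals: grain radius 2048, tolerance fraction 1/225) with `0 < δ` replaced by `16/5 ≤ δ`.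
  (The tree's `RepetitiveNetworkReductionDiluteRung.repetitiveRigidity_rung_dilute`, `δ ≥ 4`, is stated in the superseded
  g16 shape 1024 / 1/100.)  Texture / Nash / aperiodicity / grain / collar / recurrence hypotheses are carried verbatim
  and unused.

LADDER CEILING (honest, BC9): one-point evaporation can never pass `δ₁ = (A₆/(6|e⋆|))^{1/6} ≈ 1.30` even with the sharp
fcc lattice constant `A₆ ≈ 14.45` in place of `250` and the true `e⋆ ≈ −0.7176`; the physical nearest-neighbour regime
`≈ 0.97` (hard core `7/10` in the crux) is out of reach of ALL one-point tests (kissing energy `K(7/10) > 3 ≫ |e⋆|`,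
ContactSaturationLadder) — the rung is a BC5 witness of weakness, not progress on the content.  0 sorry.
-/

set_option maxHeartbeats 400000

noncomputable section

namespace Summit.AtomisticToContinuum.Crystallization.Theorems.RepetitiveNetworkReductionSeparationRung

open Literature.MathematicalPhysics.StatisticalMechanics
open Summit.AtomisticToContinuum.Crystallization.Theorems.ChargedEnergyGapNegative
  (eStar eStar_le_groundStateEnergy_div dimer dimer_injective interactionEnergy_dimer)
open Summit.AtomisticToContinuum.Crystallization.Theorems.GrainCoreNetworkSplitDiluteRung (rung_evaporableAtom)
open Summit.AtomisticToContinuum.Crystallization.Theorems.FrustratedLawDichotomyPeriodicRungs (neg_le_tsum_lennardJones)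

/-- **The evaporation ladder.**  If `e⋆ ≤ e_up` and a `δ`-separated environment can offer at most
`(250/6)·δ⁻⁶ < −e_up` of binding, then no `δ`-separated point set containing `x` is an `e⋆`-μGSC of `V_LJ`
(removal surgery `n = 1`, `k = 0` at `x`). [folklore] -/
theorem not_isMuGSC_eStar_of_binding_lt {δ e_up : ℝ} (hδ0 : 0 < δ) (hup : eStar ≤ e_up)
    (hlt : 250 / 6 * δ⁻¹ ^ 6 < -e_up) {S : Set (EuclideanSpace ℝ (Fin 3))}
    {x : EuclideanSpace ℝ (Fin 3)} (hx : x ∈ S) (hsep : ∀ a ∈ S, ∀ b ∈ S, a ≠ b → δ ≤ dist a b) :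
    ¬ IsMuGSC lennardJones eStar S := by
  have h1 := neg_le_tsum_lennardJones hδ0 hsep hx
  have hset : (S \ {x}) = {y : EuclideanSpace ℝ (Fin 3) | y ∈ S ∧ y ≠ x} := by
    ext y; simp
  refine rung_evaporableAtom hx ?_
  rw [hset]
  have h5 : eStar < ∑' y : {y : EuclideanSpace ℝ (Fin 3) // y ∈ S ∧ y ≠ x}, lennardJones (dist x y.1) := by
    linarith
  exact h5

/-- **Evaporation at separation `16/5`.**  A `δ`-separated (`δ ≥ 16/5`) point set containing `x` is not an `e⋆`-μGSC of
`V_LJ`: `(250/6)·δ⁻⁶ ≤ (250/6)·(5/16)⁶ < 1/24 ≤ −e⋆`. [folklore] -/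
theorem not_isMuGSC_eStar_of_sep {δ : ℝ} (hδ : 16 / 5 ≤ δ) {S : Set (EuclideanSpace ℝ (Fin 3))}
    {x : EuclideanSpace ℝ (Fin 3)} (hx : x ∈ S) (hsep : ∀ a ∈ S, ∀ b ∈ S, a ≠ b → δ ≤ dist a b) :
    ¬ IsMuGSC lennardJones eStar S := by
  have hδ0 : 0 < δ := by linarith
  have h3 : δ⁻¹ ^ 6 ≤ (16 / 5 : ℝ)⁻¹ ^ 6 :=
    pow_le_pow_left₀ (inv_nonneg.2 hδ0.le) ((inv_le_inv₀ hδ0 (by norm_num)).2 hδ) 6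
  have h4 : ((16 / 5 : ℝ)⁻¹) ^ 6 = 15625 / 16777216 := by norm_num
  rw [h4] at h3
  -- `e⋆ ≤ −1/24` (periodised unit dimer; = `PricedLinkCensusLocalToGlobalPhaseGap.eStar_le_neg`, whose module is not
  -- co-built with this chain on the farm — inlined as a local `have`, as in `GrainCoreNetworkSplitDiluteRung`)
  have h2 : eStar ≤ -1 / 24 := by
    have h1' : eStar ≤ groundStateEnergy lennardJones 3 2 / 2 := by
      simpa using eStar_le_groundStateEnergy_div (N := 2) two_pos
    have h2' : groundStateEnergy lennardJones 3 2 ≤ -1 / 12 := by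
      have := groundStateEnergy_lennardJones_le (d := 3) dimer_injective
      rwa [interactionEnergy_dimer] at this
    linarith
  refine not_isMuGSC_eStar_of_binding_lt hδ0 h2 ?_ hx hsep
  nlinarith

/-- **SEPARATION RUNG `δ ≥ 16/5` of `stub_repetitiveRigidity`** (Line A of crux `RepetitiveNetworkLawGap`, route
RepetitiveNetworkReduction; EXACT binder shape of the CURRENT registered stub text, skeleton ff3c3003…, with `0 < δ`
replaced by `16 / 5 ≤ δ`): a rooted `δ`-separated (`δ ≥ 16/5`) textured Nash non-periodic grain-free core-free uniformly
recurrent point set is not an `e⋆`-μGSC of `V_LJ`. [folklore] -/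
theorem repetitiveRigidity_rung_sep :
    ∀ δ : ℝ, 16 / 5 ≤ δ → ∀ S : Set (EuclideanSpace ℝ (Fin 3)), let Gy : ℝ → (N : ℕ) → (Fin N → EuclideanSpace ℝ (Fin 3)) → Fin N → Prop := fun η N y j => let d : ℝ := sInf ((fun z => dist z (y (j : Fin N))) '' (Set.range (y) \ {(y (j : Fin N))})); let T : Set (EuclideanSpace ℝ (Fin 3)) := {z : EuclideanSpace ℝ (Fin 3) | z ∈ Set.range (y) ∧ z ≠ (y (j : Fin N)) ∧ dist z (y (j : Fin N)) < 13 / 10 * d}; ∃ A : EuclideanSpace ℝ (Fin 3) →ₗᵢ[ℝ] EuclideanSpace ℝ (Fin 3), (∃ e : ↥T ≃ ↥Literature.Geometry.DiscreteGeometry.fccKissingPattern, ∀ t : ↥T, dist (d⁻¹ • ((t : EuclideanSpace ℝ (Fin 3)) - (y (j : Fin N)))) (A ((e t : ↥Literature.Geometry.DiscreteGeometry.fccKissingPattern) : EuclideanSpace ℝ (Fin 3))) ≤ η) ∨ (∃ e : ↥T ≃ ↥Literature.Geometry.DiscreteGeometry.hcpKissingPattern, ∀ t : ↥T, dist (d⁻¹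 • ((t : EuclideanSpace ℝ (Fin 3)) - (y (j : Fin N)))) (A ((e t : ↥Literature.Geometry.DiscreteGeometry.hcpKissingPattern) : EuclideanSpace ℝ (Fin 3))) ≤ η); let TexBall : (N : ℕ) → (Fin N → EuclideanSpace ℝ (Fin 3)) → Fin N → ℝ → ℝ → ℝ → ℝ → Prop := fun N y i R R₇ R₈ R₉ => (∀ a b : Fin N, a ≠ b → (7 : ℝ) / 10 ≤ dist (y a) (y b)) ∧ (∀ j : Fin N, dist (y j) (y i) ≤ R → ¬ Gy (1 / 20) N (y) j) ∧ (∀ j : Fin N, dist (y j) (y i) ≤ R → ¬ ((∀ j' : Fin N, dist (y j') (y j) ≤ R₇ → ¬ Gy (1 / 20) N (y) j') ∧ (∀ z : EuclideanSpace ℝ (Fin 3), dist z (y j) ≤ R₇ → ∃ k : Fin N, dist z (y k) ≤ 1) ∧ (∀ j' : Fin N, dist (y j') (y j) ≤ R₇ → (let d : ℝ := sInf ((fun z => dist z (y j')) '' (Set.range (y) \ {(y j')})); ∀ k : Fin N, y k ≠ y j' → dist (y k) (y j') < 27 / 20 * d → 5 ≤ Nat.card {m : Fin N // y m ≠ y j'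 ∧ dist (y m) (y j') < 27 / 20 * d ∧ y m ≠ y k ∧ dist (y m) (y k) < 27 / 20 * d})))) ∧ (∀ j : Fin N, dist (y j) (y i) ≤ R → ∃ k : Fin N, dist (y k) (y j) ≤ R₈ ∧ Gy (1 / 8) N (y) k) ∧ (∀ j : Fin N, dist (y j) (y i) ≤ R → ¬ ((∀ j' : Fin N, dist (y j') (y j) ≤ R₉ → ¬ Gy (1 / 20) N (y) j') ∧ (Nat.card {j' : Fin N // dist (y j') (y j) ≤ R₉ ∧ ¬ Gy (1 / 8) N (y) j'} : ℝ) ≤ 1 / 2 * (Nat.card {j' : Fin N // dist (y j') (y j) ≤ R₉} : ℝ) ∧ (∀ j' : Fin N, dist (y j') (y j) ≤ R₉ → ¬ Gy (1 / 8) N (y) j' → ¬ (let d : ℝ := sInf ((fun z => dist z (y j')) '' (Set.range (y) \ {(y j')})); ∀ k : Fin N, y k ≠ y j' → dist (y k) (y j') < 27 / 20 * d → 5 ≤ Nat.card {m : Fin N // y m ≠ y j' ∧ dist (y m) (y j') < 27 / 20 * d ∧ y m ≠ y k ∧ dist (y m) (y k) < 27 / 20 * d})))); let ApprS : Set (EuclideanSpace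 ℝ (Fin 3)) → ℝ → ℝ → ℝ → Prop := fun S R₇ R₈ R₉ => ∀ q : EuclideanSpace ℝ (Fin 3), q ∈ S → ∀ R ε : ℝ, 0 < ε → ∃ (N : ℕ) (y : Fin N → EuclideanSpace ℝ (Fin 3)) (i : Fin N), TexBall N y i R R₇ R₈ R₉ ∧ (∀ p : EuclideanSpace ℝ (Fin 3), p ∈ S → dist p q ≤ R → ∃ k : Fin N, dist (y k - y i) (p - q) ≤ ε) ∧ (∀ k : Fin N, dist (y k) (y i) ≤ R → ∃ p : EuclideanSpace ℝ (Fin 3), p ∈ S ∧ dist (y k - y i) (p - q) ≤ ε); let NashS : Set (EuclideanSpace ℝ (Fin 3)) → Prop := fun S => ∀ p : EuclideanSpace ℝ (Fin 3), p ∈ S → ∀ y : EuclideanSpace ℝ (Fin 3), (∀ q : EuclideanSpace ℝ (Fin 3), q ∈ S → q ≠ p → y ≠ q) → ∑' q : {q : EuclideanSpace ℝ (Fin 3) // q ∈ S ∧ q ≠ p}, Literature.MathematicalPhysics.StatisticalMechanics.lennardJones (dist p (q : EuclideanSpace ℝ (Fin 3))) ≤ ∑' q : {q : EuclideanSpace ℝ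 (Fin 3) // q ∈ S ∧ q ≠ p}, Literature.MathematicalPhysics.StatisticalMechanics.lennardJones (dist y (q : EuclideanSpace ℝ (Fin 3))); let GyS : ℝ → Set (EuclideanSpace ℝ (Fin 3)) → EuclideanSpace ℝ (Fin 3) → Prop := fun η S x => let d : ℝ := sInf ((fun z => dist z x) '' (S \ {x})); let T : Set (EuclideanSpace ℝ (Fin 3)) := {z : EuclideanSpace ℝ (Fin 3) | z ∈ S ∧ z ≠ x ∧ dist z x < 13 / 10 * d}; ∃ A : EuclideanSpace ℝ (Fin 3) →ₗᵢ[ℝ] EuclideanSpace ℝ (Fin 3), (∃ e : ↥T ≃ ↥Literature.Geometry.DiscreteGeometry.fccKissingPattern, ∀ t : ↥T, dist (d⁻¹ • ((t : EuclideanSpace ℝ (Fin 3)) - x)) (A ((e t : ↥Literature.Geometry.DiscreteGeometry.fccKissingPattern) : EuclideanSpace ℝ (Fin 3))) ≤ η) ∨ (∃ e : ↥T ≃ ↥Literature.Geometry.DiscreteGeometry.hcpKissingPattern, ∀ t : ↥T, dist (d⁻¹ • ((t : EuclideanSpace ℝ (Fin 3)) - x)) (A ((e t : ↥Literature.Geometry.DiscreteGeometry.hcpKissingPattern)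 : EuclideanSpace ℝ (Fin 3))) ≤ η); let Band : (EuclideanSpace ℝ (Fin 3) →L[ℝ] EuclideanSpace ℝ (Fin 3)) → Prop := fun A => ∀ v : EuclideanSpace ℝ (Fin 3), 9 / 10 * ‖v‖ ≤ ‖A v‖ ∧ ‖A v‖ ≤ 11 / 10 * ‖v‖; let Tmpl : (EuclideanSpace ℝ (Fin 3) →L[ℝ] EuclideanSpace ℝ (Fin 3)) → (ℤ → ℤ) → EuclideanSpace ℝ (Fin 3) → EuclideanSpace ℝ (Fin 3) → Set (EuclideanSpace ℝ (Fin 3)) := fun A s c x => (fun b : EuclideanSpace ℝ (Fin 3) => x + A (b - c)) '' Literature.MathematicalPhysics.StatisticalMechanics.barlowStacking 1 (Real.sqrt (2 / 3)) s; let CollarS : Set (EuclideanSpace ℝ (Fin 3)) → EuclideanSpace ℝ (Fin 3) → Prop := fun S x => ∃ (A : EuclideanSpace ℝ (Fin 3) →L[ℝ] EuclideanSpace ℝ (Fin 3)) (s : ℤ → ℤ) (c : EuclideanSpace ℝ (Fin 3)), Literature.MathematicalPhysics.StatisticalMechanics.IsHaggSeq s ∧ Band A ∧ (∀ y ∈ S,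 2 ≤ dist y x → dist y x ≤ 6 → ∃ p ∈ Tmpl A s c x, dist y p ≤ 1 / 50) ∧ (∀ p ∈ Tmpl A s c x, 2 ≤ dist p x → dist p x ≤ 6 → ∃ y ∈ S, dist y p ≤ 1 / 50); let GrainS : Set (EuclideanSpace ℝ (Fin 3)) → EuclideanSpace ℝ (Fin 3) → Prop := fun S x => ∃ (A : EuclideanSpace ℝ (Fin 3) →L[ℝ] EuclideanSpace ℝ (Fin 3)) (s : ℤ → ℤ) (c : EuclideanSpace ℝ (Fin 3)), Literature.MathematicalPhysics.StatisticalMechanics.IsHaggSeq s ∧ Band A ∧ (Set.ncard {y : EuclideanSpace ℝ (Fin 3) | y ∈ S ∧ dist y x ≤ 2048 ∧ ∀ p ∈ Tmpl A s c x, 1 / 225 < dist y p} : ℝ) + (Set.ncard {p : EuclideanSpace ℝ (Fin 3) | p ∈ Tmpl A s c x ∧ dist p x ≤ 2048 ∧ ∀ y ∈ S, 1 / 225 < dist y p} : ℝ) ≤ 1 / 1000 * (Set.ncard {y : EuclideanSpace ℝ (Fin 3) | y ∈ S ∧ dist y x ≤ 2048} : ℝ); let UR : Set (EuclideanSpace ℝ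 (Fin 3)) → Prop := fun S => ∀ R ε : ℝ, 0 < ε → ∃ G : ℝ, ∀ w ∈ S, ∃ g ∈ S, dist g w ≤ G ∧ (∀ s ∈ S, dist s (0 : EuclideanSpace ℝ (Fin 3)) ≤ R → ∃ a ∈ S, dist (a - g) s ≤ ε) ∧ (∀ a ∈ S, dist (a - g) (0 : EuclideanSpace ℝ (Fin 3)) ≤ R → ∃ s ∈ S, dist (a - g) s ≤ ε); (0 : EuclideanSpace ℝ (Fin 3)) ∈ S → (∀ p ∈ S, ∀ q ∈ S, p ≠ q → δ ≤ dist p q) → (∃ R₇ R₈ R₉ : ℝ, ApprS S R₇ R₈ R₉) → NashS S → (¬ ∃ (Q : Literature.MathematicalPhysics.StatisticalMechanics.PeriodicConfiguration 3) (t : EuclideanSpace ℝ (Fin 3)), S = (fun s => s + t) '' Q.points) → (¬ ∃ x : EuclideanSpace ℝ (Fin 3), GrainS S x) → (¬ ∃ x : EuclideanSpace ℝ (Fin 3), x ∈ S ∧ ¬ GyS (1 / 8) S x ∧ CollarS S x) → UR S → ¬ Literature.MathematicalPhysics.StatisticalMechanics.IsMuGSC Literature.MathematicalPhysics.StatisticalMechanics.lennardJones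 (⨅ Q : Literature.MathematicalPhysics.StatisticalMechanics.PeriodicConfiguration 3, Q.energyPerParticle Literature.MathematicalPhysics.StatisticalMechanics.lennardJones) S := by
  intro δ hδ S
  dsimp only
  intro h0 hsep _ _ _ _ _ _
  exact not_isMuGSC_eStar_of_sep hδ h0 hsep

end Summit.AtomisticToContinuum.Crystallization.Theorems.RepetitiveNetworkReductionSeparationRung
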